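import Summits.BirchSwinnertonDyer.BirchSwinnertonDyer.Theses.PrintCf2
import Literature.NumberTheory.EllipticCurves.BSDRootNumberSmallConductorAssemblyProofs
import Literature.NumberTheory.EllipticCurves.Rank1Residual.Typed.Basic
import HarnessLib

/-!
# Children 27850 / 27851 of crux `PrintCf2.SplitBadTwoRankOneOfFacts` — the SMALL-CONDUCTOR slice `N_W < 5000` (`U_{<5000}` / `D_{<5000}`):
# both halves of `BSD₂` BY NAME from Creutz–Miller (bsd.S31) and GZK

Cell `bsd-print-cf2`, seat `bsd-line-cf2-p1` g8 (LEAD on crux stmt-BirchSwinnertonDyer-20368). Planner g16 RULING (y) (5): «U_{<5000} (N_W ∈ {784, 3136}: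
Miller by name …) lands as a `--supports stmt-BirchSwinnertonDyer-27850` lemma by any idle seat, no item». THEOREMS ONLY (0 definitions, 0 named
facts, 0 `sorry`); CONDITIONAL on the displayed prints. BSD is proved for no curve by any of this beyond what the cited computer-assisted theorem
already asserts; no summit statement is proved by this seat.

The class of the crux (CM by `ℚ(√−7)`, bad at `2`, `r_an = 1`: minimal models of `49a^{(d)}`, `d ≢ 1 (mod 4)`) meets `N_W < 5000` exactly in the
isogeny classes of conductor `784 = 2⁴·7²` (`d = −1`) and `3136 = 2⁶·7²` (`d = −2`) — the two in-tree anchors of line `rubin_value_two`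
(`RubinValueTwo.anchor_two_inTree`, p637992). No classification is needed: Creutz–Miller's theorem (bsd.S31, tree fact
`bsdTriple_of_rank_le_one_of_conductor_lt`: RANK ∧ SHAFIN ∧ LEAD for every `E/ℚ` of Mordell–Weil rank `≤ 1` and conductor `< 5000`) + GZK
(`rank = r_an` for `r_an ≤ 1`, first conjunct of 𝔅_split) give `BSD(W, p)` for EVERY prime `p` and EVERY globally minimal `W` with `r_an(W) ≤ 1`,
`N_W < 5000` (`forall_bsdp_of_bsdTriple'`), hence both Miller halves at `2`.

* `bsdp_of_analyticRank_le_one_of_conductor_lt` — S31 + GZK ⟹ `BSDp W p` (any `p`), for `r_an(W) ≤ 1`, `N_W < 5000`;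
* `missingUpperBoundAt_two_of_conductor_lt` / `missingLowerBoundAt_two_of_conductor_lt` — the two halves at `2`;
* `splitBadTwoUpperHalfOfFacts_of_conductor_lt` / `splitBadTwoLowerHalfOfFacts_of_conductor_lt` — the child cruxes RESTRICTED to `N_W < 5000`,
  BY NAME up to the extra binder `W.conductorNorm ℤ < 5000`, granted S31 (`𝔅_split` supplies GZK).

References: [CreutzMiller2012] Thm. 1.1; [Miller2011LMS] §1, Def. 1.1, Thm. 1.2; [LawsonWuthrich2016] §5; [GrossZagier1986]; [Kolyvagin1990] Thm. A.
-/

set_option autoImplicit false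

-- D-0017 layout: summit = sub-problem, so `Summit.BirchSwinnertonDyer.BirchSwinnertonDyer.…` is the mandated namespace of Theorems files.
set_option linter.dupNamespace false

noncomputable section

open scoped Classical

namespace Summit.BirchSwinnertonDyer.BirchSwinnertonDyer.Theorems.PrintCf2.EisensteinTwo

open WeierstrassCurve Literature.NumberTheory.EllipticCurves Literature.NumberTheory.EllipticCurves.Rank1Residual
  Literature.NumberTheory.EllipticCurves.Rank1Residual.Typed

/-- **`BSD(W, p)` for every `p` below conductor `5000` in analytic rank `≤ 1`** — Creutz–Miller (bsd.S31, stated for Mordell–Weil rank `≤ 1`)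
with GZK converting `r_an ≤ 1` into `rank = r_an ≤ 1`, then Miller's «BSD ⟹ BSD(E,p)» (`forall_bsdp_of_bsdTriple'`). CONDITIONAL on `hS31`,
`hGZK`. [cite: CreutzMiller2012, Thm. 1.1] [cite: Miller2011LMS, §1, Def. 1.1 and Thm. 1.2] -/
theorem bsdp_of_analyticRank_le_one_of_conductor_lt (hS31 : bsdTriple_of_rank_le_one_of_conductor_lt)
    (hGZK : rank_eq_analyticRank_of_analyticRank_le_one)
    (W : WeierstrassCurve ℚ) [W.IsElliptic] [W.IsGloballyMinimal] (hr : W.analyticRank ≤ 1) (hN : W.conductorNorm ℤ < 5000)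
    (p : ℕ) (hp : p.Prime) : BSDp W p := by
  obtain ⟨hrank, -⟩ := hGZK W hr
  exact forall_bsdp_of_bsdTriple' W (hS31 W (by rw [hrank]; exact hr) hN) p hp

/-- **The Kolyvagin half at `2` below conductor `5000`** (`U_{<5000}`): `MissingUpperBoundAt W 2` for every globally minimal `W` with
`r_an(W) ≤ 1`, `N_W < 5000`. [cite: CreutzMiller2012, Thm. 1.1] [cite: Miller2011LMS, Def. 1.1] -/
theorem missingUpperBoundAt_two_of_conductor_lt (hS31 : bsdTriple_of_rank_le_one_of_conductor_lt)
    (hGZK : rank_eq_analyticRank_of_analyticRank_le_one)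
    (W : WeierstrassCurve ℚ) [W.IsElliptic] [W.IsGloballyMinimal] (hr : W.analyticRank ≤ 1) (hN : W.conductorNorm ℤ < 5000) :
    MissingUpperBoundAt W 2 := by
  obtain ⟨-, hfin⟩ := hGZK W hr
  haveI : Finite W.sha := hfin
  exact (lower_and_upper_of_missingPPartAt W 2
    (missingPPartAt_of_bsdp W 2 (bsdp_of_analyticRank_le_one_of_conductor_lt hS31 hGZK W hr hN 2 Nat.prime_two))).2

/-- **The Eisenstein half at `2` below conductor `5000`** (`D_{<5000}`): `MissingLowerBoundAt W 2` for every globally minimal `W` with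
`r_an(W) ≤ 1`, `N_W < 5000`. [cite: CreutzMiller2012, Thm. 1.1] [cite: Miller2011LMS, Def. 1.1] -/
theorem missingLowerBoundAt_two_of_conductor_lt (hS31 : bsdTriple_of_rank_le_one_of_conductor_lt)
    (hGZK : rank_eq_analyticRank_of_analyticRank_le_one)
    (W : WeierstrassCurve ℚ) [W.IsElliptic] [W.IsGloballyMinimal] (hr : W.analyticRank ≤ 1) (hN : W.conductorNorm ℤ < 5000) :
    MissingLowerBoundAt W 2 := by
  obtain ⟨-, hfin⟩ := hGZK W hr
  haveI : Finite W.sha := hfin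
  exact (lower_and_upper_of_missingPPartAt W 2
    (missingPPartAt_of_bsdp W 2 (bsdp_of_analyticRank_le_one_of_conductor_lt hS31 hGZK W hr hN 2 Nat.prime_two))).1

/-- **Child crux 27850 `SplitBadTwoUpperHalfOfFacts` RESTRICTED TO `N_W < 5000`, granted bsd.S31** — the route statement verbatim with one
extra binder `W.conductorNorm ℤ < 5000` (the slice `{784, 3136}` of the class: `d = −1, −2`); GZK is the first conjunct of 𝔅_split, the CM /
split / bad hypotheses are idle. CONDITIONAL on `hS31`. [cite: CreutzMiller2012, Thm. 1.1] [cite: Miller2011LMS, Def. 1.1] -/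
theorem splitBadTwoUpperHalfOfFacts_of_conductor_lt (hS31 : bsdTriple_of_rank_le_one_of_conductor_lt) :
    (Literature.NumberTheory.EllipticCurves.rank_eq_analyticRank_of_analyticRank_le_one ∧ WeierstrassCurve.hasEntireLFunction_rat ∧
        WeierstrassCurve.bsdRHS_eq_of_isIsogenous ∧ Literature.NumberTheory.EllipticCurves.bsdTriple_of_hasCM_of_L_one_ne_zero ∧
        Literature.NumberTheory.EllipticCurves.KrizLi2019.thm112_bsdTwo_twist) →
    ∀ (W : WeierstrassCurve ℚ) [W.IsElliptic] [W.IsGloballyMinimal], W.HasCM → W.analyticRank = 1 → CMSplit W 2 → ¬ Good W 2 →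
      W.conductorNorm ℤ < 5000 → MissingUpperBoundAt W 2 := by
  intro hB W _ _ _hCM hr _hsplit _hng hN
  exact missingUpperBoundAt_two_of_conductor_lt hS31 hB.1 W (by rw [hr]) hN

/-- **Child crux 27851 `SplitBadTwoLowerHalfOfFacts` RESTRICTED TO `N_W < 5000`, granted bsd.S31** (the Eisenstein twin of the previous
theorem). CONDITIONAL on `hS31`. [cite: CreutzMiller2012, Thm. 1.1] [cite: Miller2011LMS, Def. 1.1] -/
theorem splitBadTwoLowerHalfOfFacts_of_conductor_lt (hS31 : bsdTriple_of_rank_le_one_of_conductor_lt) :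
    (Literature.NumberTheory.EllipticCurves.rank_eq_analyticRank_of_analyticRank_le_one ∧ WeierstrassCurve.hasEntireLFunction_rat ∧
        WeierstrassCurve.bsdRHS_eq_of_isIsogenous ∧ Literature.NumberTheory.EllipticCurves.bsdTriple_of_hasCM_of_L_one_ne_zero ∧
        Literature.NumberTheory.EllipticCurves.KrizLi2019.thm112_bsdTwo_twist) →
    ∀ (W : WeierstrassCurve ℚ) [W.IsElliptic] [W.IsGloballyMinimal], W.HasCM → W.analyticRank = 1 → CMSplit W 2 → ¬ Good W 2 →
      W.conductorNorm ℤ < 5000 → MissingLowerBoundAt W 2 := by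
  intro hB W _ _ _hCM hr _hsplit _hng hN
  exact missingLowerBoundAt_two_of_conductor_lt hS31 hB.1 W (by rw [hr]) hN

end Summit.BirchSwinnertonDyer.BirchSwinnertonDyer.Theorems.PrintCf2.EisensteinTwo

end
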